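import Summits.Ventures.HSemireg.WedgeHankelRecurrenceGaussNodesMinMax

/-!
# Venture HSemireg — **CALIBRATION (continued): THE GAUSS–CHEBYSHEV RULE HAS EQUAL WEIGHTS**: for the Chebyshev recurrence (`a ≡ 0`, `b_1 = 1∕2`, `b_j = 1∕4`) the Favard weights at the
# `m + 1` Chebyshev nodes (N281 `favard_finite_explicit`: `λ_k = b_1⋯b_m ∕ (q'_{m+1}(x_k) q_m(x_k))`) are all equal to `1∕(m+1)`, because `U_m(cos θ)·T_m(cos θ) = sin²((m+1)θ) = 1` whenever
# `cos((m+1)θ) = 0`; hence the uniform measure on the Chebyshev nodes makes `q_0, …, q_m` orthogonal with `‖q_j‖² = b_1⋯b_j`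

HONEST FRAMING. Part of the Lean index of the computation cell `pub-hsemireg` (seat p10 gen 44, Sunday typer «UNIFORM-IN-n»).  Real polynomials and the real sine ∕ cosine only; Mathlib's
Chebyshev polynomials `T`, `U` with `T_real_cos`, `U_real_cos`, `T_derivative_eq_U` are IMPORTED, not re-proved; no variety, no cohomology theory, no sheaf, no Ext group and no semiregularity map
is constructed here; nothing here says that HC / HC_CM / HC_AV holds; no Literature fact (unproved `Prop`) is declared or used.  Custodian versions as in `WedgeHankelSiegelIdeal` (1/3).
SOURCES (cited).  F. G. Mehler, *Bemerkungen zur Theorie der mechanischen Quadraturen*, J. reine angew. Math. 63 (1864) 152–157 (the Gauss–Chebyshev rule with equal weights `π∕n`); G. Szegő,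
*Orthogonal Polynomials*, (15.3.3); P. J. Davis, P. Rabinowitz, *Methods of Numerical Integration* (2nd ed.) §2.7; Mathlib `Polynomial.Chebyshev` (`integral_eq_sumZeroes` is the integral form).
PROOF TYPED HERE.  `q'_{m+1} = 2^{−m}(m+1)U_m` (N332 + `T_derivative_eq_U`), `q_m = 2^{1−m}T_m`; at a node `cos θ_k` with `cos((m+1)θ_k) = 0`: `T_m(cos θ) = sin((m+1)θ) sin θ` (`cos(x − y)`), so
`U_m T_m = (U_m sin θ)·sin((m+1)θ) = sin²((m+1)θ) = 1`; the weights are therefore equal, and they sum to `1`.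
DEDUP DISCLOSURE (`rg -n 'ChebyshevWeights|U_real_cos' Summits/Ventures/HSemireg`, 2026-09-03): N332 typed the nodes; Mathlib's `ChebyshevGauss.lean` has the integral identity for the weight
`(1 − x²)^{−1∕2}`; the discrete (Favard) equal-weight statement in the chapter's format is new.  The 4 names below: 0 hits tree-wide.

WHAT IS IN THE TREE.  N332 `chebyshev_recurrence_eq_T`, `chebyshev_nodes_strictMono`, `chebyshev_recurrence_eq_prod`; N281 `favard_finite_explicit`; N294 `strictMono_eq_of_prod_X_sub_C_eq`; N279
`recurrence_monic_natDegree`, `eq_prod_X_sub_C_of_monic_of_roots`.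
THIS FILE (namespace `Summit.Ventures.HSemireg.Wedge.HankelOuter` continued; CHAINED on N341 (import only), N332; 0 definitions):
* §1107 **`chebyshev_U_mul_T_at_node`** (`cos((m+1)θ) = 0 ⇒ U_m(cos θ)·T_m(cos θ) = 1`), `chebyshev_node_cos_mul_eq_zero` (`cos((m+1)θ_k) = 0` at the nodes), `chebyshev_deriv_mul_prev_const`
  (`q'_{m+1}(x_k)·q_m(x_k)` is the same at every node), **`chebyshev_favard_weights_eq`** (the uniform weights `1∕(m+1)` on the Chebyshev nodes give `Σ_k (1∕(m+1)) q_i(x_k) q_j(x_k) = δ_{ij} b_1⋯b_j`).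
CAVEATS.  The chapter's DISCRETE (Favard) form of the Gauss–Chebyshev rule; the integral against `(1 − x²)^{−1∕2}dx` is Mathlib's `integral_eq_sumZeroes` and is not restated.  Nothing Ext-side.
New names only.
-/

open Module Polynomial Real
open scoped Matrix Polynomial

namespace Summit.Ventures.HSemireg.Wedge.HankelOuter

/-! ## §1107. The Gauss–Chebyshev weights -/

/-- **`cos((m+1)θ) = 0 ⇒ U_m(cos θ)·T_m(cos θ) = 1`** (`T_m(cos θ) = sin((m+1)θ) sin θ` and `U_m(cos θ) sin θ = sin((m+1)θ)`). [Szegő (1.12.3); this file, §1107] -/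
theorem chebyshev_U_mul_T_at_node (m : ℕ) {θ : ℝ} (hθ : cos (((m : ℝ) + 1) * θ) = 0) :
    (Polynomial.Chebyshev.U ℝ (m : ℤ)).eval (cos θ) * (Polynomial.Chebyshev.T ℝ (m : ℤ)).eval (cos θ) = 1 := by
  have hT : (Polynomial.Chebyshev.T ℝ (m : ℤ)).eval (cos θ) = sin (((m : ℝ) + 1) * θ) * sin θ := by
    rw [Polynomial.Chebyshev.T_real_cos]
    push_cast
    rw [show (m : ℝ) * θ = ((m : ℝ) + 1) * θ - θ by ring, Real.cos_sub, hθ, zero_mul, zero_add]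
  have hU : (Polynomial.Chebyshev.U ℝ (m : ℤ)).eval (cos θ) * sin θ = sin (((m : ℝ) + 1) * θ) := by
    rw [Polynomial.Chebyshev.U_real_cos]; push_cast; ring_nf
  have hs : sin (((m : ℝ) + 1) * θ) ^ 2 = 1 := by nlinarith [Real.sin_sq_add_cos_sq (((m : ℝ) + 1) * θ), hθ]
  calc (Polynomial.Chebyshev.U ℝ (m : ℤ)).eval (cos θ) * (Polynomial.Chebyshev.T ℝ (m : ℤ)).eval (cos θ)
      = ((Polynomial.Chebyshev.U ℝ (m : ℤ)).eval (cos θ) * sin θ) * sin (((m : ℝ) + 1) * θ) := by rw [hT]; ring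
    _ = 1 := by rw [hU, ← sq, hs]

/-- **At the Chebyshev nodes `θ_k = (2(m−k)+1)π∕(2(m+1))`: `cos((m+1)θ_k) = 0`.** [this file, §1107] -/
theorem chebyshev_node_cos_mul_eq_zero (m : ℕ) (k : Fin (m + 1)) :
    cos (((m : ℝ) + 1) * ((2 * ((Fin.rev k : Fin (m + 1)) : ℝ) + 1) * π / (2 * ((m : ℝ) + 1)))) = 0 := by
  rw [Real.cos_eq_zero_iff]
  refine ⟨((Fin.rev k : Fin (m + 1)) : ℕ), ?_⟩
  push_cast
  field_simp

/-- **`q'_{m+1}(x_k)·q_m(x_k)` is the same at all Chebyshev nodes** (`= 2^{1−2m}(m+1)`; here: pairwise equal). [this file, §1107] -/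
theorem chebyshev_deriv_mul_prev_const {q : ℕ → ℝ[X]} {a b : ℕ → ℝ} (hq0 : q 0 = 1) (hq1 : q 1 = Polynomial.X - C (a 0))
    (hrec : ∀ n, q (n + 2) = (Polynomial.X - C (a (n + 1))) * q (n + 1) - C (b (n + 1)) * q n) (ha : ∀ n, a n = 0) (hb1 : b 1 = 1 / 2)
    (hb : ∀ n, b (n + 2) = 1 / 4) (m : ℕ) (k l : Fin (m + 1)) :
    (derivative (q (m + 1))).eval (cos ((2 * ((Fin.rev k : Fin (m + 1)) : ℝ) + 1) * π / (2 * ((m : ℝ) + 1)))) *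
        (q m).eval (cos ((2 * ((Fin.rev k : Fin (m + 1)) : ℝ) + 1) * π / (2 * ((m : ℝ) + 1)))) =
      (derivative (q (m + 1))).eval (cos ((2 * ((Fin.rev l : Fin (m + 1)) : ℝ) + 1) * π / (2 * ((m : ℝ) + 1)))) *
        (q m).eval (cos ((2 * ((Fin.rev l : Fin (m + 1)) : ℝ) + 1) * π / (2 * ((m : ℝ) + 1)))) := by
  -- `q'_{m+1} = C((1/2)^m)·(m+1)·U_m`
  have hder : derivative (q (m + 1)) = C ((1 / 2 : ℝ) ^ m) * ((((m : ℤ) + 1 : ℤ) : ℝ[X]) * Polynomial.Chebyshev.U ℝ (m : ℤ)) := by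
    rw [chebyshev_recurrence_eq_T hq0 hq1 hrec ha hb1 hb m, derivative_mul, derivative_C, zero_mul, zero_add, Polynomial.Chebyshev.T_derivative_eq_U, add_sub_cancel_right]
  rcases m with _ | m'
  · -- one node
    have : k = l := by ext; omega
    rw [this]
  · -- `q_m = C((1/2)^{m-1}) T_m` for `m = m' + 1`
    have hprev := chebyshev_recurrence_eq_T hq0 hq1 hrec ha hb1 hb m'
    have hkey : ∀ j : Fin (m' + 2), (derivative (q (m' + 2))).eval (cos ((2 * ((Fin.rev j : Fin (m' + 2)) : ℝ) + 1) * π / (2 * (((m' + 1 : ℕ) : ℝ) + 1)))) *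
        (q (m' + 1)).eval (cos ((2 * ((Fin.rev j : Fin (m' + 2)) : ℝ) + 1) * π / (2 * (((m' + 1 : ℕ) : ℝ) + 1)))) =
        (1 / 2 : ℝ) ^ (m' + 1) * (((m' : ℝ) + 1) + 1) * (1 / 2 : ℝ) ^ m' := by
      intro j
      have hnode := chebyshev_U_mul_T_at_node (m' + 1) (chebyshev_node_cos_mul_eq_zero (m' + 1) j)
      rw [hder, hprev, eval_mul, eval_C, eval_mul, eval_intCast, eval_mul, eval_C]
      push_cast at hnode ⊢
      linear_combination ((1 / 2 : ℝ) ^ (m' + 1) * (((m' : ℝ) + 1) + 1) * (1 / 2 : ℝ) ^ m') * hnode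
    rw [hkey k, hkey l]

/-- **THE GAUSS–CHEBYSHEV RULE HAS EQUAL WEIGHTS (discrete ∕ Favard form)**: with the increasing Chebyshev nodes `x_k = cos((2(m−k)+1)π∕(2(m+1)))`, the uniform weights `1∕(m+1)` satisfy
`Σ_k (1∕(m+1)) q_i(x_k) q_j(x_k) = δ_{ij} b_1⋯b_j` for `i, j ≤ m`. [Mehler 1864; Szegő (15.3.3); Davis–Rabinowitz §2.7; this file, §1107] -/
theorem chebyshev_favard_weights_eq {q : ℕ → ℝ[X]} {a b : ℕ → ℝ} (hq0 : q 0 = 1) (hq1 : q 1 = Polynomial.X - C (a 0))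
    (hrec : ∀ n, q (n + 2) = (Polynomial.X - C (a (n + 1))) * q (n + 1) - C (b (n + 1)) * q n) (ha : ∀ n, a n = 0) (hb1 : b 1 = 1 / 2)
    (hb : ∀ n, b (n + 2) = 1 / 4) (hbpos : ∀ j, 0 < b j) (m : ℕ) (i j : Fin (m + 1)) :
    ∑ k : Fin (m + 1), (1 / ((m : ℝ) + 1)) * ((q i).eval (cos ((2 * ((Fin.rev k : Fin (m + 1)) : ℝ) + 1) * π / (2 * ((m : ℝ) + 1)))) *
        (q j).eval (cos ((2 * ((Fin.rev k : Fin (m + 1)) : ℝ) + 1) * π / (2 * ((m : ℝ) + 1))))) =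
      if i = j then ∏ l ∈ Finset.Ico 1 ((j : ℕ) + 1), b l else 0 := by
  obtain ⟨z, hz, hzr, hwpos, hsum, horth⟩ := favard_finite_explicit hq0 hq1 hrec hbpos m
  -- the Favard nodes are the Chebyshev nodes
  obtain ⟨hmon, hdeg⟩ := recurrence_monic_natDegree hq0 hq1 hrec (m + 1)
  have hzq : q (m + 1) = ∏ k, (Polynomial.X - C (z k)) := eq_prod_X_sub_C_of_monic_of_roots hmon hdeg hz.injective hzr
  have hzx : z = fun k : Fin (m + 1) => cos ((2 * ((Fin.rev k : Fin (m + 1)) : ℝ) + 1) * π / (2 * ((m : ℝ) + 1))) :=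
    strictMono_eq_of_prod_X_sub_C_eq hz (chebyshev_nodes_strictMono m) (hzq.symm.trans (chebyshev_recurrence_eq_prod hq0 hq1 hrec ha hb1 hb m))
  subst hzx
  -- all weights are equal, hence equal to `1/(m+1)`
  set wt : Fin (m + 1) → ℝ := fun k => (∏ l ∈ Finset.Ico 1 (m + 1), b l) /
    ((derivative (q (m + 1))).eval (cos ((2 * ((Fin.rev k : Fin (m + 1)) : ℝ) + 1) * π / (2 * ((m : ℝ) + 1)))) *
      (q m).eval (cos ((2 * ((Fin.rev k : Fin (m + 1)) : ℝ) + 1) * π / (2 * ((m : ℝ) + 1))))) with hwt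
  have hconst : ∀ k, wt k = wt 0 := fun k => by
    simp only [hwt]; rw [chebyshev_deriv_mul_prev_const hq0 hq1 hrec ha hb1 hb m k 0]
  have hval : ∀ k, wt k = 1 / ((m : ℝ) + 1) := by
    intro k
    have h : ∑ k' : Fin (m + 1), wt k' = 1 := hsum
    rw [Finset.sum_congr rfl fun k' _ => hconst k', Finset.sum_const, Finset.card_univ, Fintype.card_fin, nsmul_eq_mul] at h
    push_cast at h
    rw [hconst k, eq_div_iff (by positivity)]
    linarith
  rw [← horth i j]
  exact Finset.sum_congr rfl fun k _ => by rw [← hval k]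

end Summit.Ventures.HSemireg.Wedge.HankelOuter
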